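import Summits.ResolutionOfSingularities.ResolutionOfSingularities.Theorems.FrobeniusLadderFInjectiveMacaulayficationPolynomialLocalizationClauseAtPrime
import Summits.ResolutionOfSingularities.ResolutionOfSingularities.Theorems.FrobeniusLadderFInjectiveMacaulayficationFiLocusOpenOfAffine
import Mathlib.RingTheory.Flat.FaithfullyFlat.Algebra
import Mathlib.RingTheory.Flat.Localization
import Mathlib.RingTheory.KrullDimension.Polynomial
import Mathlib.AlgebraicGeometry.AffineScheme
import Literature.RingTheory.HilbertSamuel.LocalizedPolynomial
import HarnessLib

/-!
# The FC′ ANTECEDENT at the cylinder point: `η = 𝔪_{y₀}·R[t]` is non-closed, F-bad when `y₀` is, and all its proper generizations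
# satisfy the clause (crux `FInjectiveMacaulayfication` stmt-ResolutionOfSingularities-15315, chain w45a, hole #3γ; seat res-L1-w45a-stub-3)

[OURS · L1 W4.5a] Support file (`--supports stmt-ResolutionOfSingularities-15315 --as helper`); NOT a statement of any manuscript; no named
fact; AI-written (AI review is weaker than expert review).

The cylinder rungs `…FCForallExistsCylinder(Fin)` / `…FCForallExistsCylinderT11Char7` inhabit the CONCLUSION of the v29 door stub
`GenericFibreReduction.FCForallExists` at the point `η = 𝔪_{y₀}·R[t]` of `X₁ = Spec R[t]`. This file supplies the ANTECEDENT of that statement at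
the same point, so that the rungs are tight instances (the conclusion holds where the hypotheses hold, not vacuously). For `R` Noetherian of
characteristic `p` and `y₀ ∈ Spec R` a closed point:

* §1 `not_isMaximal_map_C`, `not_isClosed_of_asIdeal_eq_map_C` — `η` is NOT a closed point (`𝔪₀R[t] ⊊ 𝔪₀R[t] + (t) ⊊ R[t]`);
* §2 `clause_atPrime_polynomial_of_under` — **the clause at `R[t]_Q` from the clause at the ONE local ring `R_{Q ∩ R}`** (the proof of
  `PolynomialLocalizationClause.clause_polynomial_atPrime` run at a single prime: `R[t]_Q ≅ (R_𝔭[t])_{Q'}` + `clause_polynomial_localization`);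
  hence `fClause_stalk_of_specializes_ne`: if every local ring of `R` other than `y₀` satisfies the clause (`hoff`), every PROPER GENERIZATION
  of `η` does (`Q ⊊ 𝔪₀R[t]` forces `Q ∩ R ≠ 𝔪₀`);
* §3 `fClause_of_fClause_map_C` — **FAITHFULLY FLAT DESCENT of Frobenius-closedness of parameter ideals along `R_{𝔪₀} → R[t]_{𝔪₀R[t]} = R_{𝔪₀}(t)`**:
  if every parameter ideal of `R[t]_{𝔪₀R[t]}` is Frobenius closed then so is every parameter ideal of `R_{𝔪₀}` (`A → A(t)` is flat and local,
  hence faithfully flat — Mathlib `Module.FaithfullyFlat.of_flat_of_isLocalHom`; `(s)A(t)` is again a parameter ideal since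
  `dim A(t) = dim A` (`Polynomial.height_map_C`) and `𝔪_{A(t)} = 𝔪_A·A(t)`; Frobenius brackets extend along ring maps and
  `(s)A(t) ∩ A = (s)` by `Ideal.comap_map_eq_self_of_faithfullyFlat`); contrapositive `not_fClause_map_C`: **`y₀` F-bad ⟹ `η` F-bad**;
* §4 `cylinder_antecedent` — the three antecedent clauses of `FCForallExists` at `(Spec R[t], η)` in its scheme-stalk currency, from
  `IsClosed {y₀}`, `hoff` and F-badness of `𝒪_{Spec R, y₀}`.

No definitions, no named facts. [folklore; cite: Matsumura1987, Thm. 7.5 (faithful flatness) and Thm. 15.1 (dimension of fibres)]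
-/

-- single-problem summit: the doubled namespace component is forced
set_option linter.dupNamespace false

noncomputable section

open Polynomial IsLocalRing RingTheory.Sequence AlgebraicGeometry

namespace Summit.ResolutionOfSingularities.ResolutionOfSingularities.Theorems.FInjectiveMacaulayfication.FCForallExistsCylinderAntecedent

open Summit.ResolutionOfSingularities.ResolutionOfSingularities.Theorems.FInjectiveMacaulayfication

/-! ## §1 `𝔪₀·R[t]` is not a maximal ideal -/

section NotClosed

variable {R : Type} [CommRing R]

/-- `t ∉ I·R[t]` for a proper ideal `I`. [folklore] -/
theorem X_not_mem_map_C {I : Ideal R} (hI : I ≠ ⊤) : (X : R[X]) ∉ I.map (C : R →+* R[X]) := by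
  intro h
  apply hI
  rw [Ideal.eq_top_iff_one]
  simpa using Ideal.mem_map_C_iff.mp h 1

/-- **`I·R[t]` is never maximal** (`I` proper): `I·R[t] ⊊ I·R[t] + (t)`, and the latter is proper since it lies in the kernel of
`R[t] → R/I`, `t ↦ 0`. [folklore] -/
theorem not_isMaximal_map_C {I : Ideal R} (hI : I ≠ ⊤) : ¬ (I.map (C : R →+* R[X])).IsMaximal := by
  intro hmax
  -- the ring map `R[t] → R/I`, `t ↦ 0`
  let φ : R[X] →+* R ⧸ I := (Ideal.Quotient.mk I).comp (evalRingHom 0)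
  have hJ : I.map (C : R →+* R[X]) ⊔ Ideal.span {(X : R[X])} ≤ RingHom.ker φ := by
    refine sup_le ?_ ?_
    · rw [Ideal.map_le_iff_le_comap]
      intro a ha
      rw [Ideal.mem_comap, RingHom.mem_ker]
      change Ideal.Quotient.mk I (eval 0 (C a)) = 0
      rw [eval_C, Ideal.Quotient.eq_zero_iff_mem]
      exact ha
    · rw [Ideal.span_singleton_le_iff_mem, RingHom.mem_ker]
      change Ideal.Quotient.mk I (eval 0 (X : R[X])) = 0
      rw [eval_X, map_zero]
  have hne : RingHom.ker φ ≠ ⊤ := by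
    haveI : Nontrivial (R ⧸ I) := Ideal.Quotient.nontrivial_iff.mpr hI
    exact RingHom.ker_ne_top φ
  have hlt : I.map (C : R →+* R[X]) < I.map (C : R →+* R[X]) ⊔ Ideal.span {(X : R[X])} :=
    lt_of_le_of_ne le_sup_left fun h =>
      X_not_mem_map_C hI (h ▸ Ideal.mem_sup_right (Ideal.mem_span_singleton_self X))
  exact hne (top_le_iff.mp ((hmax.out.2 _ hlt).symm.le.trans hJ))

/-- **The point `η = 𝔪₀·R[t]` of `Spec R[t]` is not closed** (`𝔪₀` proper). [folklore] -/
theorem not_isClosed_of_asIdeal_eq_map_C {I : Ideal R} (hI : I ≠ ⊤) (η : Spec (.of R[X]))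
    (hη : η.asIdeal = I.map (C : R →+* R[X])) : ¬ IsClosed ({η} : Set (Spec (.of R[X]))) := fun h =>
  not_isMaximal_map_C hI (hη ▸ (PrimeSpectrum.isClosed_singleton_iff_isMaximal η).mp h)

end NotClosed

/-! ## §2 The clause at `R[t]_Q` from the clause at `R_{Q ∩ R}` -/

set_option maxHeartbeats 800000 in
-- localization-of-localization instance bookkeeping, as in `PolynomialLocalizationClause.clause_polynomial_atPrime`
/-- **The clause at `R[t]_Q` from the clause at the single local ring `R_𝔭`, `𝔭 = Q ∩ R`** (`R` Noetherian of characteristic `p`):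
`R[t]_Q ≅ (R_𝔭[t])_{Q'}` (`Polynomial.isLocalization`, localization of a localization) and `PolynomialLocalizationClause.clause_polynomial_localization`
over the local ring `R_𝔭`. This is `clause_polynomial_atPrime` with its hypothesis confined to the one prime that matters. [folklore] -/
theorem clause_atPrime_polynomial_of_under (p : ℕ) [Fact p.Prime] {R : Type} [CommRing R] [IsNoetherianRing R] [CharP R p]
    (Q : Ideal R[X]) [Q.IsPrime]
    (hA : ∀ d : ℕ, ringKrullDim (Localization.AtPrime (Q.comap (C : R →+* R[X]))) = d →
      ∀ s : Fin d → Localization.AtPrime (Q.comap (C : R →+* R[X])), (Ideal.span (Set.range s)).radical.IsMaximal →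
        IsWeaklyRegular (Localization.AtPrime (Q.comap (C : R →+* R[X]))) (List.ofFn s) ∧
        ∀ y : Localization.AtPrime (Q.comap (C : R →+* R[X])), (∃ e : ℕ, y ^ p ^ e ∈ Ideal.span
          ((fun z : Localization.AtPrime (Q.comap (C : R →+* R[X])) => z ^ p ^ e) ''
            (Ideal.span (Set.range s) : Set (Localization.AtPrime (Q.comap (C : R →+* R[X])))))) → y ∈ Ideal.span (Set.range s)) :
    ∀ d : ℕ, ringKrullDim (Localization.AtPrime Q) = d → ∀ s : Fin d → Localization.AtPrime Q,
      (Ideal.span (Set.range s)).radical.IsMaximal →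
      IsWeaklyRegular (Localization.AtPrime Q) (List.ofFn s) ∧
      ∀ y : Localization.AtPrime Q, (∃ e : ℕ, y ^ p ^ e ∈ Ideal.span
        ((fun z : Localization.AtPrime Q => z ^ p ^ e) ''
          (Ideal.span (Set.range s) : Set (Localization.AtPrime Q)))) → y ∈ Ideal.span (Set.range s) := by
  -- `𝔭 = Q ∩ R`, `S = R_𝔭[t]` a localization of `R[t]`
  set 𝔭 : Ideal R := Q.comap (C : R →+* R[X]) with h𝔭
  haveI : CharP (Localization.AtPrime 𝔭) p := DegreeZeroDescent.charP_localization_atPrime p 𝔭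
  letI algS : Algebra R[X] (Localization.AtPrime 𝔭)[X] := Polynomial.algebra R (Localization.AtPrime 𝔭)
  haveI hS : IsLocalization (𝔭.primeCompl.map (C : R →+* R[X])) (Localization.AtPrime 𝔭)[X] :=
    Polynomial.isLocalization 𝔭.primeCompl (Localization.AtPrime 𝔭)
  have halgS : ∀ f : R[X], algebraMap R[X] (Localization.AtPrime 𝔭)[X] f = f.map (algebraMap R (Localization.AtPrime 𝔭)) :=
    fun f => rfl
  have hdisj : Disjoint (↑(𝔭.primeCompl.map (C : R →+* R[X])) : Set R[X]) (↑Q : Set R[X]) := by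
    rw [Set.disjoint_left]
    rintro _ ⟨a, ha, rfl⟩ haQ
    exact ha haQ
  -- `Q' = Q·S`, a prime of `S` over `Q` and over the maximal ideal of `R_𝔭`
  haveI hQ' : (Q.map (algebraMap R[X] (Localization.AtPrime 𝔭)[X])).IsPrime :=
    IsLocalization.isPrime_of_isPrime_disjoint (𝔭.primeCompl.map (C : R →+* R[X])) (Localization.AtPrime 𝔭)[X] Q
      inferInstance hdisj
  have hunder : (Q.map (algebraMap R[X] (Localization.AtPrime 𝔭)[X])).comap (algebraMap R[X] (Localization.AtPrime 𝔭)[X]) = Q :=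
    IsLocalization.under_map_of_isPrime_disjoint (𝔭.primeCompl.map (C : R →+* R[X])) (Localization.AtPrime 𝔭)[X]
      inferInstance hdisj
  have hQ'c : (Q.map (algebraMap R[X] (Localization.AtPrime 𝔭)[X])).comap (C : Localization.AtPrime 𝔭 →+* (Localization.AtPrime 𝔭)[X]) =
      maximalIdeal (Localization.AtPrime 𝔭) := by
    have hcomp : (C : Localization.AtPrime 𝔭 →+* (Localization.AtPrime 𝔭)[X]).comp (algebraMap R (Localization.AtPrime 𝔭)) =
        (algebraMap R[X] (Localization.AtPrime 𝔭)[X]).comp (C : R →+* R[X]) :=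
      RingHom.ext fun a => by rw [RingHom.comp_apply, RingHom.comp_apply, halgS, map_C]
    have h1 : ((Q.map (algebraMap R[X] (Localization.AtPrime 𝔭)[X])).comap
        (C : Localization.AtPrime 𝔭 →+* (Localization.AtPrime 𝔭)[X])).under R = 𝔭 := by
      rw [Ideal.under_def, Ideal.comap_comap, hcomp, ← Ideal.comap_comap, hunder]
    calc (Q.map (algebraMap R[X] (Localization.AtPrime 𝔭)[X])).comap (C : Localization.AtPrime 𝔭 →+* (Localization.AtPrime 𝔭)[X])
        = (((Q.map (algebraMap R[X] (Localization.AtPrime 𝔭)[X])).comap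
            (C : Localization.AtPrime 𝔭 →+* (Localization.AtPrime 𝔭)[X])).under R).map (algebraMap R (Localization.AtPrime 𝔭)) :=
          (IsLocalization.map_under (M := 𝔭.primeCompl) (S := Localization.AtPrime 𝔭) _).symm
      _ = 𝔭.map (algebraMap R (Localization.AtPrime 𝔭)) := by rw [h1]
      _ = maximalIdeal (Localization.AtPrime 𝔭) := IsLocalization.AtPrime.map_eq_maximalIdeal 𝔭 _
  -- the clause at `T = S_{Q'}` from the clause at the local ring `R_𝔭` alone
  have hT := PolynomialLocalizationClause.clause_polynomial_localization p (Localization.AtPrime 𝔭) hA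
    (Q.map (algebraMap R[X] (Localization.AtPrime 𝔭)[X])) hQ'c
  -- `T` is the localization of `R[t]` at `Q`
  haveI : IsLocalization.AtPrime (Localization.AtPrime (Q.map (algebraMap R[X] (Localization.AtPrime 𝔭)[X]))) Q := by
    have h := IsLocalization.isLocalization_isLocalization_atPrime_isLocalization (𝔭.primeCompl.map (C : R →+* R[X]))
      (T := Localization.AtPrime (Q.map (algebraMap R[X] (Localization.AtPrime 𝔭)[X])))
      (Q.map (algebraMap R[X] (Localization.AtPrime 𝔭)[X]))
    have hM : ((Q.map (algebraMap R[X] (Localization.AtPrime 𝔭)[X])).comap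
        (algebraMap R[X] (Localization.AtPrime 𝔭)[X])).primeCompl = Q.primeCompl := by
      ext x
      rw [Ideal.mem_primeCompl_iff, Ideal.mem_primeCompl_iff, hunder]
    change IsLocalization Q.primeCompl _
    rw [← hM]
    exact h
  let e : Localization.AtPrime (Q.map (algebraMap R[X] (Localization.AtPrime 𝔭)[X])) ≃+* Localization.AtPrime Q :=
    (IsLocalization.algEquiv Q.primeCompl
      (Localization.AtPrime (Q.map (algebraMap R[X] (Localization.AtPrime 𝔭)[X]))) (Localization.AtPrime Q)).toRingEquiv
  exact DegreeZeroDescent.inlineClause_of_ringEquiv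
    (L := Localization.AtPrime (Q.map (algebraMap R[X] (Localization.AtPrime 𝔭)[X]))) (L' := Localization.AtPrime Q) p e hT

/-! ## §3 Faithfully flat descent of Frobenius-closedness along `R_{𝔪₀} → R[t]_{𝔪₀R[t]}` -/

set_option maxHeartbeats 800000 in
-- as in §2: localization-of-localization instance bookkeeping
/-- **Frobenius-closed parameter ideals DESCEND from `R[t]_{𝔪₀R[t]} = R_{𝔪₀}(t)` to `R_{𝔪₀}`** (`R` Noetherian of characteristic `p`, `𝔪₀`
maximal). The local map `A = R_{𝔪₀} → A(t)` is flat (polynomial extension, then localization) and local, hence FAITHFULLY FLAT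
(`Module.FaithfullyFlat.of_flat_of_isLocalHom`); `dim A(t) = ht(𝔪₀R[t]) = ht 𝔪₀ = dim A` (`Polynomial.height_map_C`) and `𝔪_{A(t)} = 𝔪_A·A(t)`, so
the extension `(s)A(t)` of a parameter ideal `(s)` of `A` is a parameter ideal of `A(t)`; if `y^q ∈ (s)^[q]` in `A` then the same holds in
`A(t)`, so `y ∈ (s)A(t) ∩ A = (s)` (`Ideal.comap_map_eq_self_of_faithfullyFlat`). Realised on `T = (A[t])_{(𝔪₀R[t])·A[t]} ≅ R[t]_{𝔪₀R[t]}`.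
[cite: Matsumura1987, Thm. 7.5 and Thm. 15.1] -/
theorem fClause_of_fClause_map_C (p : ℕ) [Fact p.Prime] {R : Type} [CommRing R] [IsNoetherianRing R] [CharP R p]
    (𝔪₀ : Ideal R) [h𝔪 : 𝔪₀.IsMaximal] (P : Ideal R[X]) [P.IsPrime] (hP : P = 𝔪₀.map (C : R →+* R[X]))
    (h : ∀ d : ℕ, ringKrullDim (Localization.AtPrime P) = d → ∀ s : Fin d → Localization.AtPrime P,
      (Ideal.span (Set.range s)).radical.IsMaximal →
      ∀ y : Localization.AtPrime P, (∃ e : ℕ, y ^ p ^ e ∈ Ideal.span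
        ((fun z : Localization.AtPrime P => z ^ p ^ e) '' (Ideal.span (Set.range s) : Set (Localization.AtPrime P)))) →
        y ∈ Ideal.span (Set.range s)) :
    ∀ d : ℕ, ringKrullDim (Localization.AtPrime 𝔪₀) = d → ∀ s : Fin d → Localization.AtPrime 𝔪₀,
      (Ideal.span (Set.range s)).radical.IsMaximal →
      ∀ y : Localization.AtPrime 𝔪₀, (∃ e : ℕ, y ^ p ^ e ∈ Ideal.span
        ((fun z : Localization.AtPrime 𝔪₀ => z ^ p ^ e) '' (Ideal.span (Set.range s) : Set (Localization.AtPrime 𝔪₀)))) →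
        y ∈ Ideal.span (Set.range s) := by
  classical
  -- `P ∩ R = 𝔪₀`
  have hPc : P.comap (C : R →+* R[X]) = 𝔪₀ := by rw [hP, Literature.RingTheory.HilbertSamuel.comap_C_map_C R 𝔪₀]
  -- `A = R_{𝔪₀}`, `S = A[t]` a localization of `R[t]`, `P' = P·S`, `T = S_{P'}`
  letI algS : Algebra R[X] (Localization.AtPrime 𝔪₀)[X] := Polynomial.algebra R (Localization.AtPrime 𝔪₀)
  haveI hS : IsLocalization (𝔪₀.primeCompl.map (C : R →+* R[X])) (Localization.AtPrime 𝔪₀)[X] :=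
    Polynomial.isLocalization 𝔪₀.primeCompl (Localization.AtPrime 𝔪₀)
  have halgS : ∀ f : R[X], algebraMap R[X] (Localization.AtPrime 𝔪₀)[X] f = f.map (algebraMap R (Localization.AtPrime 𝔪₀)) :=
    fun f => rfl
  have hcomp : (C : Localization.AtPrime 𝔪₀ →+* (Localization.AtPrime 𝔪₀)[X]).comp (algebraMap R (Localization.AtPrime 𝔪₀)) =
      (algebraMap R[X] (Localization.AtPrime 𝔪₀)[X]).comp (C : R →+* R[X]) :=
    RingHom.ext fun a => by rw [RingHom.comp_apply, RingHom.comp_apply, halgS, map_C]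
  have hdisj : Disjoint (↑(𝔪₀.primeCompl.map (C : R →+* R[X])) : Set R[X]) (↑P : Set R[X]) := by
    rw [Set.disjoint_left]
    rintro _ ⟨a, ha, rfl⟩ haP
    exact ha (by rw [← hPc]; exact haP)
  set P' : Ideal (Localization.AtPrime 𝔪₀)[X] := P.map (algebraMap R[X] (Localization.AtPrime 𝔪₀)[X]) with hP'def
  haveI hP' : P'.IsPrime :=
    IsLocalization.isPrime_of_isPrime_disjoint (𝔪₀.primeCompl.map (C : R →+* R[X])) (Localization.AtPrime 𝔪₀)[X] P
      inferInstance hdisj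
  have hunder : P'.comap (algebraMap R[X] (Localization.AtPrime 𝔪₀)[X]) = P :=
    IsLocalization.under_map_of_isPrime_disjoint (𝔪₀.primeCompl.map (C : R →+* R[X])) (Localization.AtPrime 𝔪₀)[X]
      inferInstance hdisj
  -- `P' = 𝔪_A·A[t]`
  have hPA : (maximalIdeal (Localization.AtPrime 𝔪₀)).map (C : Localization.AtPrime 𝔪₀ →+* (Localization.AtPrime 𝔪₀)[X]) = P' := by
    rw [← IsLocalization.AtPrime.map_eq_maximalIdeal 𝔪₀ (Localization.AtPrime 𝔪₀), Ideal.map_map, hcomp, ← Ideal.map_map, ← hP]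
  -- `T` is the localization of `R[t]` at `P`
  haveI : IsLocalization.AtPrime (Localization.AtPrime P') P := by
    have h1 := IsLocalization.isLocalization_isLocalization_atPrime_isLocalization (𝔪₀.primeCompl.map (C : R →+* R[X]))
      (T := Localization.AtPrime P') P'
    have hM : (P'.comap (algebraMap R[X] (Localization.AtPrime 𝔪₀)[X])).primeCompl = P.primeCompl := by
      ext x
      rw [Ideal.mem_primeCompl_iff, Ideal.mem_primeCompl_iff, hunder]
    change IsLocalization P.primeCompl _
    rw [← hM]
    exact h1
  let e : Localization.AtPrime P' ≃+* Localization.AtPrime P :=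
    (IsLocalization.algEquiv P.primeCompl (Localization.AtPrime P') (Localization.AtPrime P)).toRingEquiv
  -- the Frobenius-closure clause on `T`
  have hT := FiLocusOpenOfAffine.fClause_of_ringEquiv p (A := Localization.AtPrime P) (B := Localization.AtPrime P') e.symm h
  -- `A → T` is faithfully flat
  haveI : Module.Flat (Localization.AtPrime 𝔪₀)[X] (Localization.AtPrime P') := IsLocalization.flat _ P'.primeCompl
  haveI : Module.Flat (Localization.AtPrime 𝔪₀) (Localization.AtPrime P') :=
    Module.Flat.trans (Localization.AtPrime 𝔪₀) (Localization.AtPrime 𝔪₀)[X] (Localization.AtPrime P')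
  have halgT : ∀ a : Localization.AtPrime 𝔪₀, algebraMap (Localization.AtPrime 𝔪₀) (Localization.AtPrime P') a =
      algebraMap (Localization.AtPrime 𝔪₀)[X] (Localization.AtPrime P') (C a) := fun a =>
    IsScalarTower.algebraMap_apply (Localization.AtPrime 𝔪₀) (Localization.AtPrime 𝔪₀)[X] (Localization.AtPrime P') a
  have hmemT : ∀ a : Localization.AtPrime 𝔪₀, a ∈ maximalIdeal (Localization.AtPrime 𝔪₀) ↔
      algebraMap (Localization.AtPrime 𝔪₀) (Localization.AtPrime P') a ∈ maximalIdeal (Localization.AtPrime P') := by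
    intro a
    rw [halgT, IsLocalization.AtPrime.to_map_mem_maximal_iff (Localization.AtPrime P') P', ← hPA, Ideal.mem_map_C_iff]
    constructor
    · intro ha n
      rw [coeff_C]
      split_ifs
      · exact ha
      · exact Ideal.zero_mem _
    · intro ha; simpa using ha 0
  haveI : IsLocalHom (algebraMap (Localization.AtPrime 𝔪₀) (Localization.AtPrime P')) := by
    refine ⟨fun a ha => ?_⟩
    by_contra hna
    have hmem : a ∈ maximalIdeal (Localization.AtPrime 𝔪₀) := hna
    exact (IsLocalRing.mem_maximalIdeal _ |>.mp ((hmemT a).mp hmem)) ha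
  have hff : @Module.FaithfullyFlat (Localization.AtPrime 𝔪₀) (Localization.AtPrime P') _ _ Algebra.toModule :=
    Module.FaithfullyFlat.of_flat_of_isLocalHom (A := Localization.AtPrime 𝔪₀) (B := Localization.AtPrime P')
  -- `𝔪_T = 𝔪_A·T` and `dim T = dim A`
  have hmaxT : (maximalIdeal (Localization.AtPrime 𝔪₀)).map (algebraMap (Localization.AtPrime 𝔪₀) (Localization.AtPrime P')) =
      maximalIdeal (Localization.AtPrime P') := by
    rw [IsScalarTower.algebraMap_eq (Localization.AtPrime 𝔪₀) (Localization.AtPrime 𝔪₀)[X] (Localization.AtPrime P'),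
      ← Ideal.map_map, show algebraMap (Localization.AtPrime 𝔪₀) (Localization.AtPrime 𝔪₀)[X] = C from rfl, hPA,
      IsLocalization.AtPrime.map_eq_maximalIdeal P' (Localization.AtPrime P')]
  have hdimT : ringKrullDim (Localization.AtPrime P') = ringKrullDim (Localization.AtPrime 𝔪₀) := by
    rw [ringKrullDim_eq_of_ringEquiv e, IsLocalization.AtPrime.ringKrullDim_eq_height P (Localization.AtPrime P),
      IsLocalization.AtPrime.ringKrullDim_eq_height 𝔪₀ (Localization.AtPrime 𝔪₀), hP, Polynomial.height_map_C]
  -- the descent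
  intro d hd s hs y hy
  obtain ⟨q, hq⟩ := hy
  set φ := algebraMap (Localization.AtPrime 𝔪₀) (Localization.AtPrime P') with hφ
  have hspan : Ideal.span (Set.range (φ ∘ s)) = (Ideal.span (Set.range s)).map φ := by
    rw [Ideal.map_span, Set.range_comp]
  -- `(s)` is `𝔪_A`-primary, so `(s)T` is `𝔪_T`-primary
  have hrad : (Ideal.span (Set.range s)).radical = maximalIdeal (Localization.AtPrime 𝔪₀) := IsLocalRing.eq_maximalIdeal hs
  have hle : Ideal.span (Set.range s) ≤ maximalIdeal (Localization.AtPrime 𝔪₀) := Ideal.le_radical.trans hrad.le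
  obtain ⟨N, hN⟩ := Ideal.exists_radical_pow_le_of_fg (Ideal.span (Set.range s)) (by rw [hrad]; exact IsNoetherian.noetherian _)
  rw [hrad] at hN
  have hle' : Ideal.span (Set.range (φ ∘ s)) ≤ maximalIdeal (Localization.AtPrime P') := by
    rw [hspan, ← hmaxT]; exact Ideal.map_mono hle
  have hpow' : maximalIdeal (Localization.AtPrime P') ^ N ≤ Ideal.span (Set.range (φ ∘ s)) := by
    rw [hspan, ← hmaxT, ← Ideal.map_pow]; exact Ideal.map_mono hN
  have hrad' : (Ideal.span (Set.range (φ ∘ s))).radical.IsMaximal := by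
    have h3 : (Ideal.span (Set.range (φ ∘ s))).radical = maximalIdeal (Localization.AtPrime P') := by
      refine le_antisymm (IsLocalRing.le_maximalIdeal fun htop => ?_) fun x hx => ⟨N, hpow' (Ideal.pow_mem_pow hx N)⟩
      rw [Ideal.radical_eq_top] at htop
      exact (IsLocalRing.maximalIdeal.isMaximal _).ne_top (top_le_iff.mp (htop.symm.le.trans hle'))
    rw [h3]; exact IsLocalRing.maximalIdeal.isMaximal _
  -- the Frobenius bracket extends along `φ`
  have hq' : φ y ^ p ^ q ∈ Ideal.span ((fun z : Localization.AtPrime P' => z ^ p ^ q) ''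
      (Ideal.span (Set.range (φ ∘ s)) : Set (Localization.AtPrime P'))) := by
    have h1 := Ideal.mem_map_of_mem φ hq
    rw [map_pow, Ideal.map_span] at h1
    refine Ideal.span_mono ?_ h1
    rintro _ ⟨w, ⟨z, hz, rfl⟩, rfl⟩
    refine ⟨φ z, ?_, by simp only [map_pow]⟩
    rw [SetLike.mem_coe, hspan]
    exact Ideal.mem_map_of_mem φ hz
  have hmem := hT d (hdimT.trans hd) (φ ∘ s) hrad' (φ y) ⟨q, hq'⟩
  rw [hspan] at hmem
  have key := (@Ideal.comap_map_eq_self_of_faithfullyFlat (Localization.AtPrime 𝔪₀) (Localization.AtPrime P') _ _ _ hff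
    (Ideal.span (Set.range s))).le
  exact key (Ideal.mem_comap.mpr hmem)

/-- **`y₀` F-bad ⟹ `η = 𝔪_{y₀}·R[t]` F-bad**: if some parameter ideal of `R_{𝔪₀}` is not Frobenius closed, then some parameter ideal of
`R[t]_{𝔪₀R[t]}` is not Frobenius closed (contrapositive of `fClause_of_fClause_map_C`). [folklore] -/
theorem not_fClause_map_C (p : ℕ) [Fact p.Prime] {R : Type} [CommRing R] [IsNoetherianRing R] [CharP R p]
    (𝔪₀ : Ideal R) [𝔪₀.IsMaximal] (P : Ideal R[X]) [P.IsPrime] (hP : P = 𝔪₀.map (C : R →+* R[X]))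
    (h : ¬ ∀ d : ℕ, ringKrullDim (Localization.AtPrime 𝔪₀) = d → ∀ s : Fin d → Localization.AtPrime 𝔪₀,
      (Ideal.span (Set.range s)).radical.IsMaximal →
      ∀ y : Localization.AtPrime 𝔪₀, (∃ e : ℕ, y ^ p ^ e ∈ Ideal.span
        ((fun z : Localization.AtPrime 𝔪₀ => z ^ p ^ e) '' (Ideal.span (Set.range s) : Set (Localization.AtPrime 𝔪₀)))) →
        y ∈ Ideal.span (Set.range s)) :
    ¬ ∀ d : ℕ, ringKrullDim (Localization.AtPrime P) = d → ∀ s : Fin d → Localization.AtPrime P,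
      (Ideal.span (Set.range s)).radical.IsMaximal →
      ∀ y : Localization.AtPrime P, (∃ e : ℕ, y ^ p ^ e ∈ Ideal.span
        ((fun z : Localization.AtPrime P => z ^ p ^ e) '' (Ideal.span (Set.range s) : Set (Localization.AtPrime P)))) →
        y ∈ Ideal.span (Set.range s) :=
  fun hP' => h (fClause_of_fClause_map_C p 𝔪₀ P hP hP')

/-! ## §4 The three antecedent clauses of `FCForallExists` at `(Spec R[t], η)` -/

/-- **THE FC′ ANTECEDENT AT THE CYLINDER POINT.** `R` Noetherian of characteristic `p`, `y₀ ∈ Spec R` a closed point whose local ring is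
F-BAD (some parameter ideal not Frobenius closed) while every other local ring of `R` satisfies the per-stalk clause (`hoff`), and
`η = 𝔪_{y₀}·R[t] ∈ Spec R[t]`. Then `η` carries the hypotheses of `GenericFibreReduction.FCForallExists` verbatim: `η` is not closed, the
stalk `𝒪_{Spec R[t], η}` is F-bad, and every proper generization `y ⤳ η`, `y ≠ η`, has all parameter ideals Frobenius closed. Together with
`FCForallExistsCylinder.fcForallExists_body_cylinder` (the conclusion at the same `η`) the cylinder rung is a TIGHT instance of the v29 stub.
[folklore assembly; cite: Matsumura1987, Thm. 7.5] -/
theorem cylinder_antecedent (p : ℕ) [Fact p.Prime] (R : Type) [CommRing R] [IsNoetherianRing R] [CharP R p]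
    (y₀ : Spec (.of R)) (hy₀ : IsClosed ({y₀} : Set (Spec (.of R))))
    (hoff : ∀ y : Spec (.of R), y ≠ y₀ → ∀ d : ℕ, ringKrullDim (Localization.AtPrime y.asIdeal) = d →
      ∀ s : Fin d → Localization.AtPrime y.asIdeal, (Ideal.span (Set.range s)).radical.IsMaximal →
        RingTheory.Sequence.IsWeaklyRegular (Localization.AtPrime y.asIdeal) (List.ofFn s) ∧
        ∀ z : Localization.AtPrime y.asIdeal, (∃ e : ℕ, z ^ p ^ e ∈ Ideal.span ((fun w : Localization.AtPrime y.asIdeal => w ^ p ^ e) ''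
          (Ideal.span (Set.range s) : Set (Localization.AtPrime y.asIdeal)))) → z ∈ Ideal.span (Set.range s))
    (hbad : ¬ ∀ d : ℕ, ringKrullDim ((Spec (.of R)).presheaf.stalk y₀) = d → ∀ s : Fin d → (Spec (.of R)).presheaf.stalk y₀,
      (Ideal.span (Set.range s)).radical.IsMaximal → ∀ t : (Spec (.of R)).presheaf.stalk y₀, (∃ e : ℕ, t ^ p ^ e ∈
        Ideal.span ((fun z : (Spec (.of R)).presheaf.stalk y₀ => z ^ p ^ e) ''
          (Ideal.span (Set.range s) : Set ((Spec (.of R)).presheaf.stalk y₀)))) → t ∈ Ideal.span (Set.range s))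
    (η : Spec (.of R[X])) (hη : η.asIdeal = y₀.asIdeal.map (C : R →+* R[X])) :
    ¬ IsClosed ({η} : Set (Spec (.of R[X]))) ∧
    ¬ (∀ d : ℕ, ringKrullDim ((Spec (.of R[X])).presheaf.stalk η) = d → ∀ s : Fin d → (Spec (.of R[X])).presheaf.stalk η,
        (Ideal.span (Set.range s)).radical.IsMaximal → ∀ t : (Spec (.of R[X])).presheaf.stalk η, (∃ e : ℕ, t ^ p ^ e ∈
          Ideal.span ((fun z : (Spec (.of R[X])).presheaf.stalk η => z ^ p ^ e) ''
            (Ideal.span (Set.range s) : Set ((Spec (.of R[X])).presheaf.stalk η)))) → t ∈ Ideal.span (Set.range s)) ∧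
    ∀ y : Spec (.of R[X]), y ⤳ η → y ≠ η →
      ∀ d : ℕ, ringKrullDim ((Spec (.of R[X])).presheaf.stalk y) = d → ∀ s : Fin d → (Spec (.of R[X])).presheaf.stalk y,
        (Ideal.span (Set.range s)).radical.IsMaximal → ∀ t : (Spec (.of R[X])).presheaf.stalk y, (∃ e : ℕ, t ^ p ^ e ∈
          Ideal.span ((fun z : (Spec (.of R[X])).presheaf.stalk y => z ^ p ^ e) ''
            (Ideal.span (Set.range s) : Set ((Spec (.of R[X])).presheaf.stalk y)))) → t ∈ Ideal.span (Set.range s) := by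
  haveI hm : y₀.asIdeal.IsMaximal := (PrimeSpectrum.isClosed_singleton_iff_isMaximal y₀).mp hy₀
  refine ⟨not_isClosed_of_asIdeal_eq_map_C hm.ne_top η hη, ?_, ?_⟩
  · -- `η` is F-bad: descend along `R_{𝔪₀} → R[t]_η`, moving scheme stalks to localizations along `Spec.stalkIso`
    intro hgood
    have h1 := FiLocusOpenOfAffine.fClause_of_ringEquiv p (A := (Spec (.of R[X])).presheaf.stalk η)
      (B := Localization.AtPrime η.asIdeal) (Spec.stalkIso (.of R[X]) η).commRingCatIsoToRingEquiv hgood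
    have h2 := fClause_of_fClause_map_C p y₀.asIdeal η.asIdeal hη h1
    exact hbad (FiLocusOpenOfAffine.fClause_of_ringEquiv p (A := Localization.AtPrime y₀.asIdeal)
      (B := (Spec (.of R)).presheaf.stalk y₀) (Spec.stalkIso (.of R) y₀).commRingCatIsoToRingEquiv.symm h2)
  · -- proper generizations: `Q ⊊ 𝔪₀R[t]` forces `Q ∩ R ≠ 𝔪₀`, so `hoff` + §2
    intro y hyη hne
    have hle : y.asIdeal ≤ η.asIdeal := (PrimeSpectrum.le_iff_specializes y η).mpr hyη
    have hne' : y.asIdeal.comap (C : R →+* R[X]) ≠ y₀.asIdeal := by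
      intro h
      apply hne
      apply PrimeSpectrum.ext
      refine le_antisymm hle ?_
      rw [hη, Ideal.map_le_iff_le_comap, h]
    let y' : Spec (.of R) := ⟨y.asIdeal.comap (C : R →+* R[X]), Ideal.comap_isPrime _ _⟩
    have hy' : y' ≠ y₀ := fun h => hne' (congrArg PrimeSpectrum.asIdeal h)
    have hfull := clause_atPrime_polynomial_of_under p y.asIdeal (hoff y' hy')
    have hfull' := DegreeZeroDescent.inlineClause_of_ringEquiv p (L := Localization.AtPrime y.asIdeal)
      (L' := (Spec (.of R[X])).presheaf.stalk y) (Spec.stalkIso (.of R[X]) y).commRingCatIsoToRingEquiv.symm hfull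
    intro d hd s hs t ht
    exact ((hfull' d hd s hs).2) t ht

end Summit.ResolutionOfSingularities.ResolutionOfSingularities.Theorems.FInjectiveMacaulayfication.FCForallExistsCylinderAntecedent

end
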